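import Mathlib
import Summits.KontsevichZagierPeriods.KontsevichZagierPeriods.Theorems.SoloInformedLogRoomPieces
import HarnessLib

/-!
# Solo-informed (A390-ii): generic pieces of a side of a prepared band

File F4e of the KERNEL LEMMA I programme.  Over a piece `P` of the base of a prepared band the
weighted fibre integral `HW`, the fibre mass `H₀` and the normalised power integral `I` satisfy a
fixed bundle of inequalities (`SoloInformedSideHyp`: `HW ≤ C_W Λᵖ H₀`, `Λ ≤ C₂ (1 + Σ|log σ|)`,
`|a| I ≍ H₀`).  From the bundle and the inductive hypothesis `SoloInformedLogRoomAt k m` we derive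
the finiteness of `∫ P.indicator HW` on three kinds of pieces:

* null pieces (`I = ∞`): `HW` vanishes almost everywhere (`soloInformed_piece_null`);
* surrogate pieces (`L·S ≤ I ≤ T·S` for a non-negative semialgebraic `S`): `soloInformed_piece_surrogate`;
* logarithmic pieces (`1/2 ≤ I ≤ log q`, semialgebraic `q ≥ 1`): `soloInformed_piece_log`, where the
  logarithm joins the weight family and the exponent `p` is raised by one.
-/

open MeasureTheory Set Real
open scoped ENNReal
open Literature.ModelTheory.ExponentialFields Literature.NumberTheory.Transcendental

namespace Summit.KontsevichZagierPeriods.KontsevichZagierPeriods.Theorems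

/-! ### Arithmetic of the comparison chains in `ℝ≥0∞` -/

/-- Upper chain: `HW ≤ C_W Λᵖ H₀`, `H₀ ≤ c A I`, `I ≤ T S`, `Λᵖ T ≤ C' Q` give
`HW ≤ (C_W C' c) · Q · (A S)`. -/
theorem soloInformed_chain_upper {HW H₀ I : ℝ≥0∞} {CW Λp c A T S Cp Q : ℝ}
    (h1 : HW ≤ ENNReal.ofReal (CW * Λp) * H₀) (h2 : H₀ ≤ ENNReal.ofReal (c * A) * I)
    (h3 : I ≤ ENNReal.ofReal (T * S)) (hΛ : Λp * T ≤ Cp * Q)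
    (hCW : 0 ≤ CW) (hΛp : 0 ≤ Λp) (hc : 0 ≤ c) (hA : 0 ≤ A) (hS : 0 ≤ S)
    (hCp : 0 ≤ Cp) (hQ : 0 ≤ Q) :
    HW ≤ ENNReal.ofReal (CW * Cp * c) * ENNReal.ofReal Q * ENNReal.ofReal (A * S) := by
  calc HW ≤ ENNReal.ofReal (CW * Λp) * H₀ := h1
    _ ≤ ENNReal.ofReal (CW * Λp) * (ENNReal.ofReal (c * A) * ENNReal.ofReal (T * S)) := by
        gcongr
        exact h2.trans (by gcongr)
    _ = ENNReal.ofReal (CW * Λp * (c * A) * (T * S)) := by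
        rw [ENNReal.ofReal_mul (by positivity : (0 : ℝ) ≤ CW * Λp * (c * A)),
          ENNReal.ofReal_mul (by positivity : (0 : ℝ) ≤ CW * Λp), mul_assoc]
    _ ≤ ENNReal.ofReal (CW * Cp * c * Q * (A * S)) := ENNReal.ofReal_le_ofReal (by
        have e1 : CW * Λp * (c * A) * (T * S) = CW * (Λp * T) * (c * A) * S := by ring
        have e2 : CW * Cp * c * Q * (A * S) = CW * (Cp * Q) * (c * A) * S := by ring
        rw [e1, e2]
        have hcA : 0 ≤ c * A := by positivity
        gcongr)
    _ = ENNReal.ofReal (CW * Cp * c) * ENNReal.ofReal Q * ENNReal.ofReal (A * S) := by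
        rw [ENNReal.ofReal_mul (by positivity : (0 : ℝ) ≤ CW * Cp * c * Q),
          ENNReal.ofReal_mul (by positivity : (0 : ℝ) ≤ CW * Cp * c)]

/-- Lower chain: `|a| I ≤ c H₀` and `L S ≤ I` (`L > 0`) give `A S ≤ (L⁻¹ c) H₀`. -/
theorem soloInformed_chain_lower {H₀ I : ℝ≥0∞} {A c L S : ℝ}
    (h4 : ENNReal.ofReal A * I ≤ ENNReal.ofReal c * H₀) (h5 : ENNReal.ofReal (L * S) ≤ I)
    (hL : 0 < L) (hA : 0 ≤ A) :
    ENNReal.ofReal (A * S) ≤ ENNReal.ofReal (L⁻¹ * c) * H₀ := by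
  have hS' : ENNReal.ofReal S ≤ ENNReal.ofReal L⁻¹ * I := by
    calc ENNReal.ofReal S = ENNReal.ofReal L⁻¹ * ENNReal.ofReal (L * S) := by
          rw [← ENNReal.ofReal_mul (inv_nonneg.mpr hL.le), ← mul_assoc, inv_mul_cancel₀ hL.ne',
            one_mul]
      _ ≤ ENNReal.ofReal L⁻¹ * I := by gcongr
  calc ENNReal.ofReal (A * S) = ENNReal.ofReal A * ENNReal.ofReal S := ENNReal.ofReal_mul hA
    _ ≤ ENNReal.ofReal A * (ENNReal.ofReal L⁻¹ * I) := by gcongr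
    _ = ENNReal.ofReal L⁻¹ * (ENNReal.ofReal A * I) := by ring
    _ ≤ ENNReal.ofReal L⁻¹ * (ENNReal.ofReal c * H₀) := by gcongr
    _ = ENNReal.ofReal (L⁻¹ * c) * H₀ := by
        rw [ENNReal.ofReal_mul (inv_nonneg.mpr hL.le), mul_assoc]

/-- The null alternative: if `I = ∞` then either the fibre mass is infinite or (when `a = 0`)
the weighted fibre integral vanishes. -/
theorem soloInformed_null_alt {HW H₀ : ℝ≥0∞} {X c A : ℝ} (hW : HW ≤ ENNReal.ofReal X * H₀)
    (h1 : ENNReal.ofReal |A| * ⊤ ≤ ENNReal.ofReal c * H₀)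
    (h2 : H₀ ≤ ENNReal.ofReal (c * |A|) * ⊤) : HW = 0 ∨ H₀ = ⊤ := by
  by_cases hA : A = 0
  · left
    have h0 : H₀ = 0 := by simpa [hA] using h2
    simpa [h0] using hW
  · right
    have hpos : ENNReal.ofReal |A| ≠ 0 := by
      have : 0 < |A| := abs_pos.mpr hA
      simpa [ENNReal.ofReal_eq_zero, not_le] using this
    rw [ENNReal.mul_top hpos, top_le_iff] at h1
    rcases ENNReal.mul_eq_top.mp h1 with h | h
    · exact h.2
    · exact absurd h.1 ENNReal.ofReal_ne_top

/-- `Λ ≤ C Q` with `Λ ≥ 0` gives `Λᵖ ≤ Cᵖ Qᵖ`. -/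
theorem soloInformed_pow_le_mul_pow {Λ C Q : ℝ} (hΛ : 0 ≤ Λ) (h : Λ ≤ C * Q) (p : ℕ) :
    Λ ^ p ≤ C ^ p * Q ^ p := by
  rw [← mul_pow]; exact pow_le_pow_left₀ hΛ h p

/-! ### Null pieces and covers up to a vanishing set -/

/-- Null piece, alternative form: if at every point of `P` either `H` vanishes or `H₀` is infinite,
and `H₀` has finite integral, then `∫ P.indicator H = 0`. -/
theorem soloInformed_nullPiece_eq_zero' {k m : ℕ} {P : Set (Fin (k + m) → ℝ)}
    {H H₀ : (Fin (k + m) → ℝ) → ℝ≥0∞} (hH₀m : Measurable H₀) (t : Fin k → ℝ)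
    (hfin : ∫⁻ x, H₀ (Fin.append t x) < ∞) (halt : ∀ w ∈ P, H w = 0 ∨ H₀ w = ⊤) :
    ∫⁻ x, P.indicator H (Fin.append t x) = 0 := by
  have hEq : P.indicator H = {w | w ∈ P ∧ H w ≠ 0}.indicator H := by
    funext z
    by_cases hz : z ∈ P
    · by_cases h0 : H z = 0
      · rw [indicator_of_mem hz, indicator_of_notMem (fun h : z ∈ {w | w ∈ P ∧ H w ≠ 0} => h.2 h0),
          h0]
      · rw [indicator_of_mem hz, indicator_of_mem (show z ∈ {w | w ∈ P ∧ H w ≠ 0} from ⟨hz, h0⟩)]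
    · rw [indicator_of_notMem hz,
        indicator_of_notMem (fun h : z ∈ {w | w ∈ P ∧ H w ≠ 0} => hz h.1)]
  rw [hEq]
  exact soloInformed_nullPiece_eq_zero hH₀m t hfin fun w hw => (halt w hw.1).resolve_left hw.2

/-- Finite covers up to a vanishing set: if every point of `B` at which `H ≠ 0` lies in one of
finitely many measurable pieces, each with finite `H`-integral, then `∫ B.indicator H < ∞`. -/
theorem soloInformed_cover_lintegral_lt_top' {k d : ℕ} {ι : Type} [Finite ι]
    {B : Set (Fin (k + d) → ℝ)} (P : ι → Set (Fin (k + d) → ℝ))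
    (hPm : ∀ i, MeasurableSet (P i)) {H : (Fin (k + d) → ℝ) → ℝ≥0∞} (hH : Measurable H)
    (hcov : ∀ w ∈ B, H w = 0 ∨ ∃ i, w ∈ P i) (t : Fin k → ℝ)
    (hfin : ∀ i, ∫⁻ x, (P i).indicator H (Fin.append t x) < ∞) :
    ∫⁻ x, B.indicator H (Fin.append t x) < ∞ := by
  have hEq : B.indicator H = {w | w ∈ B ∧ H w ≠ 0}.indicator H := by
    funext z
    by_cases hz : z ∈ B
    · by_cases h0 : H z = 0
      · rw [indicator_of_mem hz, indicator_of_notMem (fun h : z ∈ {w | w ∈ B ∧ H w ≠ 0} => h.2 h0),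
          h0]
      · rw [indicator_of_mem hz, indicator_of_mem (show z ∈ {w | w ∈ B ∧ H w ≠ 0} from ⟨hz, h0⟩)]
    · rw [indicator_of_notMem hz,
        indicator_of_notMem (fun h : z ∈ {w | w ∈ B ∧ H w ≠ 0} => hz h.1)]
  rw [hEq]
  refine soloInformed_cover_lintegral_lt_top P (fun w hw => ?_) hPm hH t hfin
  rcases hcov w hw.1 with h | ⟨i, hi⟩
  · exact absurd h hw.2
  · exact mem_iUnion.mpr ⟨i, hi⟩

/-! ### The hypothesis bundle over a piece -/

/-- The generic inequalities over a piece `P` of the base of a prepared band: semialgebraicity of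
the piece, of the weight family `σ` and of the coefficient `a`; measurability of the weighted fibre
integral `HW` and of the fibre mass `H₀`; the fibre bound `HW ≤ C_W Λᵖ H₀`; the domination
`0 ≤ Λ ≤ C₂ (1 + Σ |log σ|)`; and the two-sided comparison of `H₀` with `|a| · I`. -/
structure SoloInformedSideHyp {n : ℕ} (P : Set (Fin n → ℝ)) {ι : Type} [Fintype ι] (p : ℕ)
    (σ : ι → (Fin n → ℝ) → ℝ) (a : (Fin n → ℝ) → ℝ) (HW H₀ I : (Fin n → ℝ) → ℝ≥0∞)
    (Λ : (Fin n → ℝ) → ℝ) (CW C₂ c : ℝ) : Prop where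
  /-- the piece is `ℚ`-semialgebraic -/
  sa_P : IsSemialgebraic ℚ P
  /-- the weights are `ℚ`-semialgebraic on the piece -/
  sa_σ : ∀ x, IsSemialgebraicFunOn ℚ P (σ x)
  /-- the coefficient is `ℚ`-semialgebraic on the piece -/
  sa_a : IsSemialgebraicFunOn ℚ P a
  /-- the weighted fibre integral is measurable -/
  meas_HW : Measurable HW
  /-- the fibre mass is measurable -/
  meas_H₀ : Measurable H₀
  /-- `0 ≤ C_W` -/
  CW_nonneg : 0 ≤ CW
  /-- `0 ≤ C₂` -/
  C₂_nonneg : 0 ≤ C₂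
  /-- `0 ≤ c` -/
  c_nonneg : 0 ≤ c
  /-- the fibre bound -/
  hW : ∀ w ∈ P, HW w ≤ ENNReal.ofReal (CW * Λ w ^ p) * H₀ w
  /-- domination of `Λ` by the weights -/
  hΛ : ∀ w ∈ P, 0 ≤ Λ w ∧ Λ w ≤ C₂ * (1 + ∑ x, |Real.log (σ x w)|)
  /-- fibre mass versus `|a| · I` -/
  hmass : ∀ w ∈ P, ENNReal.ofReal |a w| * I w ≤ ENNReal.ofReal c * H₀ w ∧
    H₀ w ≤ ENNReal.ofReal (c * |a w|) * I w

namespace SoloInformedSideHyp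

variable {n : ℕ} {P : Set (Fin n → ℝ)} {ι : Type} [Fintype ι] {p : ℕ} {σ : ι → (Fin n → ℝ) → ℝ}
  {a : (Fin n → ℝ) → ℝ} {HW H₀ I : (Fin n → ℝ) → ℝ≥0∞} {Λ : (Fin n → ℝ) → ℝ} {CW C₂ c : ℝ}

/-- Restriction of the bundle to a semialgebraic sub-piece. -/
theorem mono (h : SoloInformedSideHyp P p σ a HW H₀ I Λ CW C₂ c) {P' : Set (Fin n → ℝ)}
    (hP' : P' ⊆ P) (hsa : IsSemialgebraic ℚ P') : SoloInformedSideHyp P' p σ a HW H₀ I Λ CW C₂ c where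
  sa_P := hsa
  sa_σ x := (h.sa_σ x).mono hP' hsa
  sa_a := h.sa_a.mono hP' hsa
  meas_HW := h.meas_HW
  meas_H₀ := h.meas_H₀
  CW_nonneg := h.CW_nonneg
  C₂_nonneg := h.C₂_nonneg
  c_nonneg := h.c_nonneg
  hW w hw := h.hW w (hP' hw)
  hΛ w hw := h.hΛ w (hP' hw)
  hmass w hw := h.hmass w (hP' hw)

end SoloInformedSideHyp

/-! ### The three kinds of pieces -/

variable {k m : ℕ} {P : Set (Fin (k + m) → ℝ)} {ι : Type} [Fintype ι] {p : ℕ}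
  {σ : ι → (Fin (k + m) → ℝ) → ℝ} {a : (Fin (k + m) → ℝ) → ℝ}
  {HW H₀ I : (Fin (k + m) → ℝ) → ℝ≥0∞} {Λ : (Fin (k + m) → ℝ) → ℝ} {CW C₂ c : ℝ}

/-- **Null piece**: if `I = ∞` on `P` then `∫ P.indicator HW < ∞` (indeed `= 0`). -/
theorem soloInformed_piece_null (h : SoloInformedSideHyp P p σ a HW H₀ I Λ CW C₂ c)
    (hI : ∀ w ∈ P, I w = ⊤) (t : Fin k → ℝ) (hfin : ∫⁻ x, H₀ (Fin.append t x) < ∞) :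
    ∫⁻ x, P.indicator HW (Fin.append t x) < ∞ := by
  rw [soloInformed_nullPiece_eq_zero' h.meas_H₀ t hfin fun w hw =>
    soloInformed_null_alt (h.hW w hw) (by rw [← hI w hw]; exact (h.hmass w hw).1)
      (by rw [← hI w hw]; exact (h.hmass w hw).2)]
  exact ENNReal.zero_lt_top

/-- **Surrogate piece**: if `L · S ≤ I ≤ T · S` on `P` for a non-negative `ℚ`-semialgebraic `S`
(`L > 0`), then `∫ P.indicator HW < ∞`, by the inductive hypothesis applied to the surrogate
`|a| · S` with the weights `σ`. -/
theorem soloInformed_piece_surrogate (ih : SoloInformedLogRoomAt k m)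
    (h : SoloInformedSideHyp P p σ a HW H₀ I Λ CW C₂ c)
    {S : (Fin (k + m) → ℝ) → ℝ} (hS : IsSemialgebraicFunOn ℚ P S) (hS0 : ∀ w ∈ P, 0 ≤ S w)
    {T L : ℝ} (hT : 0 ≤ T) (hL : 0 < L)
    (hup : ∀ w ∈ P, I w ≤ ENNReal.ofReal (T * S w))
    (hlow : ∀ w ∈ P, ENNReal.ofReal (L * S w) ≤ I w)
    (t : Fin k → ℝ) (hfin : ∫⁻ x, H₀ (Fin.append t x) < ∞) :
    ∫⁻ x, P.indicator HW (Fin.append t x) < ∞ := by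
  have hF' : IsSemialgebraicFunOn ℚ P (fun w => |a w| * S w) :=
    (IsSemialgebraicFunOn.mul_holds h.sa_a.abs hS).congr fun _ _ => rfl
  refine soloInformed_piece_lt_top ih h.sa_P (p' := p) hF' h.sa_σ
    (fun w hw => mul_nonneg (abs_nonneg _) (hS0 w hw))
    (K := ENNReal.ofReal (CW * (C₂ ^ p * T) * c)) (K' := ENNReal.ofReal (L⁻¹ * c))
    ENNReal.ofReal_ne_top ENNReal.ofReal_ne_top (fun w hw => ?_) (fun w hw => ?_) t
    (lt_of_le_of_lt (lintegral_mono fun x => indicator_le_self _ _ _) hfin)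
  · obtain ⟨hΛ0, hΛ⟩ := h.hΛ w hw
    have hC₂ := h.C₂_nonneg
    have hQ : 0 ≤ 1 + ∑ x, |Real.log (σ x w)| := by positivity
    have hΛ' : Λ w ^ p * T ≤ C₂ ^ p * T * (1 + ∑ x, |Real.log (σ x w)|) ^ p := by
      have := soloInformed_pow_le_mul_pow hΛ0 hΛ p
      calc Λ w ^ p * T ≤ C₂ ^ p * (1 + ∑ x, |Real.log (σ x w)|) ^ p * T :=
            mul_le_mul_of_nonneg_right this hT
        _ = _ := by ring
    exact soloInformed_chain_upper (h.hW w hw) (h.hmass w hw).2 (hup w hw) hΛ' h.CW_nonneg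
      (pow_nonneg hΛ0 p) h.c_nonneg (abs_nonneg _) (hS0 w hw) (by positivity)
      (pow_nonneg hQ p)
  · exact soloInformed_chain_lower (h.hmass w hw).1 (hlow w hw) hL (abs_nonneg _)

/-- **Logarithmic piece**: if `1/2 ≤ I ≤ log q` on `P` for a `ℚ`-semialgebraic `q ≥ 1`, then
`∫ P.indicator HW < ∞`, by the inductive hypothesis applied to the surrogate `|a|` with the
enlarged weight family `(σ, q)` and exponent `p + 1` (`Λᵖ log q ≤ C₂ᵖ (1 + Σ|log σ| + log q)ᵖ⁺¹`). -/
theorem soloInformed_piece_log (ih : SoloInformedLogRoomAt k m)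
    (h : SoloInformedSideHyp P p σ a HW H₀ I Λ CW C₂ c)
    {q : (Fin (k + m) → ℝ) → ℝ} (hq : IsSemialgebraicFunOn ℚ P q) (hq1 : ∀ w ∈ P, 1 ≤ q w)
    (hup : ∀ w ∈ P, I w ≤ ENNReal.ofReal (Real.log (q w)))
    (hlow : ∀ w ∈ P, ENNReal.ofReal (1 / 2) ≤ I w)
    (t : Fin k → ℝ) (hfin : ∫⁻ x, H₀ (Fin.append t x) < ∞) :
    ∫⁻ x, P.indicator HW (Fin.append t x) < ∞ := by
  have hσ' : ∀ j, IsSemialgebraicFunOn ℚ P (Sum.elim σ (fun _ : Unit => q) j) := by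
    rintro (i | u)
    · exact h.sa_σ i
    · exact hq
  refine soloInformed_piece_lt_top ih h.sa_P (p' := p + 1) (F' := fun w => |a w|)
    (σ := Sum.elim σ (fun _ : Unit => q)) h.sa_a.abs hσ' (fun w _ => abs_nonneg _)
    (K := ENNReal.ofReal (CW * C₂ ^ p * c)) (K' := ENNReal.ofReal ((1 / 2 : ℝ)⁻¹ * c))
    ENNReal.ofReal_ne_top ENNReal.ofReal_ne_top (fun w hw => ?_) (fun w hw => ?_) t
    (lt_of_le_of_lt (lintegral_mono fun x => indicator_le_self _ _ _) hfin)
  · obtain ⟨hΛ0, hΛ⟩ := h.hΛ w hw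
    have hC₂ := h.C₂_nonneg
    have hQ : 0 ≤ 1 + ∑ x, |Real.log (σ x w)| := by positivity
    have hlq : 0 ≤ Real.log (q w) := Real.log_nonneg (hq1 w hw)
    have hsum : 1 + ∑ j, |Real.log (Sum.elim σ (fun _ : Unit => q) j w)| =
        1 + ∑ x, |Real.log (σ x w)| + Real.log (q w) := by
      rw [Fintype.sum_sum_type]
      simp only [Sum.elim_inl, Sum.elim_inr, Finset.univ_unique, Finset.sum_singleton,
        abs_of_nonneg hlq]
      ring
    have hQ' : 0 ≤ 1 + ∑ x, |Real.log (σ x w)| + Real.log (q w) := by positivity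
    have hΛ' : Λ w ^ p * Real.log (q w) ≤
        C₂ ^ p * (1 + ∑ j, |Real.log (Sum.elim σ (fun _ : Unit => q) j w)|) ^ (p + 1) := by
      rw [hsum, pow_succ, ← mul_assoc]
      have h1 : Λ w ≤ C₂ * (1 + ∑ x, |Real.log (σ x w)| + Real.log (q w)) :=
        hΛ.trans (by nlinarith [h.C₂_nonneg])
      have h2 := soloInformed_pow_le_mul_pow hΛ0 h1 p
      have h3 : Real.log (q w) ≤ 1 + ∑ x, |Real.log (σ x w)| + Real.log (q w) := by linarith
      exact mul_le_mul h2 h3 hlq (by positivity)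
    have := soloInformed_chain_upper (S := 1) (h.hW w hw) (h.hmass w hw).2
      (by simpa using hup w hw) hΛ' h.CW_nonneg (pow_nonneg hΛ0 p) h.c_nonneg (abs_nonneg _)
      zero_le_one (by positivity) (pow_nonneg (hsum ▸ hQ') _)
    simpa using this
  · have := soloInformed_chain_lower (S := 1) (h.hmass w hw).1 (by simpa using hlow w hw)
      (by norm_num : (0 : ℝ) < 1 / 2) (abs_nonneg _)
    simpa using this

end Summit.KontsevichZagierPeriods.KontsevichZagierPeriods.Theorems
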